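import Literature.AlgebraicGeometry.Motives.HodgeLieWeightOneLeviSpanBracket
import Mathlib.LinearAlgebra.Trace
import HarnessLib

/-!
# Weight one: in a simple `Lie Hg ⊗ ℂ` no non-zero LEVI element commutes with all lowering operators
# (one-sided sharpening of N13 via the trace form `tr_V(XY)` and N15; Deligne I §3, Moonen–Zarhin 1999 (2.3))

Family `hodge`, layer `Literature/AlgebraicGeometry/Motives`; THEOREMS ONLY (no definition, no named fact; D-0026).  Written for
the cell `pub-hodgeav-hg6` (LADDER-HodgeAV row 2, TABLE X row 1 `g6.I(1)`: brick T of the Segre-compression return leg of the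
rank-twelve crux, eng-2 lineage g5; honest framing: HC / HC_AV / HC_CM NOT proved — unconditional Hodge–Lie linear algebra).

WHY.  The tree's N13 (`false_of_commute_raising_lowering_of_simple`) needs an element commuting with ALL raising AND all lowering
operators.  The Segre-compression leg produces a Levi element (the lift of the block unit `P₁₂` of the tensor skeleton) that is
only known to commute with the LOWERING operators.  This file shows that this already contradicts simplicity, by a trace-form
argument: for Levi `Z` with `[Z, 𝔥⁻] = 0` the functional `Y ↦ tr_V(ZY)` kills `𝔥⁺` and `𝔥⁻` (degree), and kills the Levi part
because it is spanned by brackets `[x, z]` (N15 `levi_mem_span_bracket_of_simple`) and `tr(Z[x,z]) = tr(Zxz) − tr(zZx) = 0`; so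
`Z` lies in the radical of the trace form on `𝔥_ℂ`, an `ad`-stable subspace, which by simplicity is `0` or `𝔥_ℂ` — and it is
not `𝔥_ℂ` since `tr(Θ²) = dim V ≠ 0`.

* §1 **`trace_eq_zero_of_apply_eq_zero_of_mem`** — an operator killing a subspace into which it maps has trace `0` (square zero).
* §2 **`LoweringCentralizer.trace_mul_eq_zero`** — `𝔥_ℂ` simple with a non-zero raising operator, `Z ∈ 𝔥_ℂ` Levi with
  `tr(Z(xz − zx)) = 0` for all raising `x`, lowering `z`: then `tr(ZY) = 0` for every `Y ∈ 𝔥_ℂ`.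
* §3 **`LoweringCentralizer.eq_zero_of_forall_trace_mul_eq_zero`** — `𝔥_ℂ` simple: an element of `𝔥_ℂ` orthogonal to `𝔥_ℂ`
  under `tr_V` is `0`.
* §4 **`false_of_levi_commute_lowering_of_simple`**, **`false_of_levi_commute_raising_of_simple`** — THE THEOREMS: in a simple
  `𝔥_ℂ` (with a non-zero raising operator) no non-zero Levi element commutes with every lowering (resp. every raising) operator.

## References

* [Deligne1982HodgeCycles] P. Deligne, *Hodge cycles on abelian varieties*, LNM 900 (1982), I §3 (Prop. 3.4, 3.6).
* [MoonenZarhin1999LowDim] B. Moonen, Yu. Zarhin, *Hodge classes on abelian varieties of low dimension*, Math. Ann. 315 (1999),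
  §2 (2.3).
* [Humphreys1972] J. E. Humphreys, *Introduction to Lie Algebras and Representation Theory*, §4.3 (Cartan's criterion: the
  radical of an invariant trace form is an ideal), §5.1.
-/

noncomputable section

open scoped TensorProduct

namespace Literature.AlgebraicGeometry.Motives

namespace HodgeStructure

universe u

/-! ## §1 Square-zero operators have trace zero -/

/-- An operator `N` that kills a subspace `P′` and takes its values in `P′` has `N² = 0`, hence trace `0`.
[cite: Humphreys1972, §4.3] -/
theorem trace_eq_zero_of_apply_eq_zero_of_mem {M : Type*} [AddCommGroup M] [Module ℂ M] {P' : Submodule ℂ M}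
    {N : Module.End ℂ M} (hNP : ∀ p ∈ P', N p = 0) (hNim : ∀ v, N v ∈ P') : LinearMap.trace ℂ M N = 0 := by
  have hNN : N * N = 0 := LinearMap.ext fun v => by rw [Module.End.mul_apply, hNP _ (hNim v), LinearMap.zero_apply]
  have hnil : IsNilpotent N := ⟨2, by rw [pow_two, hNN]⟩
  exact (LinearMap.isNilpotent_trace_of_isNilpotent hnil).eq_zero

variable {V : Type u} [AddCommGroup V] [Module ℚ V] [Module.Finite ℚ V] [HodgeTensorFacts.{u, u}] {n : ℤ}

/-! ## §2 The trace functional of a Levi element killed by brackets -/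

set_option maxHeartbeats 1600000 in
/-- **`tr(ZY) = 0` on `𝔥_ℂ`.**  `H` effective polarized of weight `1`, `𝔥_ℂ` simple with a non-zero raising operator; `Z ∈ 𝔥_ℂ`
Levi (`Z P ⊆ P`, `Z Q ⊆ Q`) with `tr_V(Z(xz − zx)) = 0` for every raising `x ∈ 𝔥_ℂ` and lowering `z ∈ 𝔥_ℂ`.  Then `tr_V(ZY) = 0`
for every `Y ∈ 𝔥_ℂ` (`Y = Y⁻ + Y⁰ + Y⁺`; `ZY^±` are square-zero; `Y⁰ ∈ span[𝔥⁺, 𝔥⁻]` by N15).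
[cite: Deligne1982HodgeCycles, I §3 (proof of Prop. 3.4)] [cite: MoonenZarhin1999LowDim, §2 (2.3)] -/
theorem LoweringCentralizer.trace_mul_eq_zero (H : HodgeStructure V n) (ψ : H.Polarization) (hn : n = 1)
    (heff : H.IsEffective)
    (hsimple : ∀ T : Submodule ℂ (Module.End ℂ (ℂ ⊗[ℚ] V)), T ≤ H.hodgeLieC → T ≠ ⊥ →
      (∀ Y ∈ H.hodgeLieC, ∀ t ∈ T, Y * t - t * Y ∈ T) → T = H.hodgeLieC)
    {B : Module.End ℂ (ℂ ⊗[ℚ] V)} (hB : B ∈ H.hodgeLieC) (hB0 : B ≠ 0) (hBP : ∀ p ∈ H.piece 1 0, B p = 0)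
    (hBim : ∀ v, B v ∈ H.piece 1 0)
    {Z : Module.End ℂ (ℂ ⊗[ℚ] V)} (hZP : ∀ p ∈ H.piece 1 0, Z p ∈ H.piece 1 0)
    (hZQ : ∀ q ∈ H.piece 0 1, Z q ∈ H.piece 0 1)
    (hZbr : ∀ x ∈ H.hodgeLieC, ∀ z ∈ H.hodgeLieC, (∀ p ∈ H.piece 1 0, x p = 0) → (∀ v, x v ∈ H.piece 1 0) →
      (∀ q ∈ H.piece 0 1, z q = 0) → (∀ v, z v ∈ H.piece 0 1) →
      LinearMap.trace ℂ (ℂ ⊗[ℚ] V) (Z * (x * z - z * x)) = 0) :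
    ∀ Y ∈ H.hodgeLieC, LinearMap.trace ℂ (ℂ ⊗[ℚ] V) (Z * Y) = 0 := by
  obtain ⟨hbr, -, -, Θ, hΘ, hΘ𝔤⟩ := hodgeLie_standing H ψ
  have hspan : H.hodgeLieC = spanC H.hodgeLie := hodgeLieC_eq_spanC H
  have hΘC : Θ ∈ H.hodgeLieC := by rw [hspan]; exact hΘ𝔤
  have hbrC : ∀ Y ∈ H.hodgeLieC, ∀ Y' ∈ H.hodgeLieC, Y * Y' - Y' * Y ∈ H.hodgeLieC := fun Y hY Y' hY' => by
    rw [hspan] at hY hY' ⊢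
    exact commutator_mem_spanC hbr hY hY'
  have hlevi := fun (Z' : Module.End ℂ (ℂ ⊗[ℚ] V)) (hZ' : Z' ∈ H.hodgeLieC) hZ'P hZ'Q =>
    levi_mem_span_bracket_of_simple H ψ hn heff hsimple hB hB0 hBP hBim hZ' hZ'P hZ'Q
  subst hn
  obtain ⟨hPmem, hQmem, hΘ10, hΘ01, hΘΘ⟩ := UnitaryTheta.theta_facts H rfl heff hΘ
  intro Y hY
  obtain ⟨Ym, hYm, Y0, hY0, Yp, hYp, hYsum, hYpP, hYpim, hYmQ, hYmim, -, -, hY0P, hY0Q⟩ :=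
    SymplecticTheta.exists_decomp H.hodgeLieC hbrC hΘC hΘΘ hΘ10 hΘ01 hPmem hQmem hY
  -- the two nilpotent pieces
  have hp : LinearMap.trace ℂ (ℂ ⊗[ℚ] V) (Z * Yp) = 0 :=
    trace_eq_zero_of_apply_eq_zero_of_mem (P' := H.piece 1 0)
      (fun p hp => by rw [Module.End.mul_apply, hYpP p hp, map_zero]) fun v => hZP _ (hYpim v)
  have hm : LinearMap.trace ℂ (ℂ ⊗[ℚ] V) (Z * Ym) = 0 :=
    trace_eq_zero_of_apply_eq_zero_of_mem (P' := H.piece 0 1)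
      (fun q hq => by rw [Module.End.mul_apply, hYmQ q hq, map_zero]) fun v => hZQ _ (hYmim v)
  -- the Levi piece, through N15
  have h0 : LinearMap.trace ℂ (ℂ ⊗[ℚ] V) (Z * Y0) = 0 := by
    have hY0span := hlevi Y0 hY0 hY0P hY0Q
    -- the functional `W ↦ tr(Z W)` vanishes on the span of the brackets
    have key : ∀ W ∈ Submodule.span ℂ {W : Module.End ℂ (ℂ ⊗[ℚ] V) | ∃ x ∈ H.hodgeLieC, ∃ z ∈ H.hodgeLieC,
        (∀ p ∈ H.piece 1 0, x p = 0) ∧ (∀ v, x v ∈ H.piece 1 0) ∧ (∀ q ∈ H.piece 0 1, z q = 0) ∧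
        (∀ v, z v ∈ H.piece 0 1) ∧ W = x * z - z * x},
        LinearMap.trace ℂ (ℂ ⊗[ℚ] V) (Z * W) = 0 := by
      intro W hW
      induction hW using Submodule.span_induction with
      | mem W hW =>
        obtain ⟨x, hx, z, hz, hxP, hxim, hzQ, hzim, rfl⟩ := hW
        exact hZbr x hx z hz hxP hxim hzQ hzim
      | zero => rw [mul_zero, map_zero]
      | add W W' _ _ h h' => rw [mul_add, map_add, h, h', add_zero]
      | smul c W _ h => rw [mul_smul_comm, map_smul, h, smul_zero]
    exact key Y0 hY0span
  rw [hYsum, mul_add, mul_add, map_add, map_add, hm, h0, hp, add_zero, add_zero]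

/-! ## §3 The radical of the trace form on a simple `𝔥_ℂ` -/

set_option maxHeartbeats 1600000 in
/-- **The trace form `tr_V(XY)` on a simple `𝔥_ℂ` has zero radical.**  `H` effective of weight `1` with `V ≠ 0`, `𝔥_ℂ` simple
(every non-zero `ad`-stable subspace is `𝔥_ℂ`); if `Z ∈ 𝔥_ℂ` satisfies `tr_V(ZY) = 0` for all `Y ∈ 𝔥_ℂ`, then `Z = 0` (the radical
is `ad`-stable by invariance `tr([X,Z]Y) = −tr(Z[X,Y])`; it is not `𝔥_ℂ` because `tr(Θ²) = tr(1) = dim V ≠ 0`).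
[cite: Humphreys1972, §4.3] [cite: Deligne1982HodgeCycles, I §3 Prop. 3.6] -/
theorem LoweringCentralizer.eq_zero_of_forall_trace_mul_eq_zero (H : HodgeStructure V n) (ψ : H.Polarization) (hn : n = 1)
    (heff : H.IsEffective) (hV : Nontrivial (ℂ ⊗[ℚ] V))
    (hsimple : ∀ T : Submodule ℂ (Module.End ℂ (ℂ ⊗[ℚ] V)), T ≤ H.hodgeLieC → T ≠ ⊥ →
      (∀ Y ∈ H.hodgeLieC, ∀ t ∈ T, Y * t - t * Y ∈ T) → T = H.hodgeLieC)
    {Z : Module.End ℂ (ℂ ⊗[ℚ] V)} (hZ : Z ∈ H.hodgeLieC)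
    (htr : ∀ Y ∈ H.hodgeLieC, LinearMap.trace ℂ (ℂ ⊗[ℚ] V) (Z * Y) = 0) : Z = 0 := by
  classical
  obtain ⟨hbr, -, -, Θ, hΘ, hΘ𝔤⟩ := hodgeLie_standing H ψ
  have hspan : H.hodgeLieC = spanC H.hodgeLie := hodgeLieC_eq_spanC H
  have hΘC : Θ ∈ H.hodgeLieC := by rw [hspan]; exact hΘ𝔤
  have hbrC : ∀ Y ∈ H.hodgeLieC, ∀ Y' ∈ H.hodgeLieC, Y * Y' - Y' * Y ∈ H.hodgeLieC := fun Y hY Y' hY' => by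
    rw [hspan] at hY hY' ⊢
    exact commutator_mem_spanC hbr hY hY'
  subst hn
  obtain ⟨-, -, -, -, hΘΘ⟩ := UnitaryTheta.theta_facts H rfl heff hΘ
  by_contra hZ0
  -- the radical of the trace form
  obtain ⟨R, hR⟩ : ∃ R : Submodule ℂ (Module.End ℂ (ℂ ⊗[ℚ] V)), ∀ Z', Z' ∈ R ↔ Z' ∈ H.hodgeLieC ∧
      ∀ Y ∈ H.hodgeLieC, LinearMap.trace ℂ (ℂ ⊗[ℚ] V) (Z' * Y) = 0 := by
    refine ⟨{ carrier := {Z' | Z' ∈ H.hodgeLieC ∧ ∀ Y ∈ H.hodgeLieC, LinearMap.trace ℂ (ℂ ⊗[ℚ] V) (Z' * Y) = 0}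
              zero_mem' := ⟨Submodule.zero_mem _, fun Y _ => by rw [zero_mul, map_zero]⟩
              add_mem' := fun {a b} ha hb => ⟨Submodule.add_mem _ ha.1 hb.1, fun Y hY => by
                rw [add_mul, map_add, ha.2 Y hY, hb.2 Y hY, add_zero]⟩
              smul_mem' := fun c a ha => ⟨Submodule.smul_mem _ _ ha.1, fun Y hY => by
                rw [smul_mul_assoc, map_smul, ha.2 Y hY, smul_zero]⟩ }, fun Z' => Iff.rfl⟩
  have hRle : R ≤ H.hodgeLieC := fun Z' hZ' => ((hR Z').1 hZ').1
  have hRne : R ≠ ⊥ := fun h => hZ0 (by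
    have hZR : Z ∈ R := (hR Z).2 ⟨hZ, htr⟩
    rw [h, Submodule.mem_bot] at hZR
    exact hZR)
  have hRstab : ∀ Y ∈ H.hodgeLieC, ∀ t ∈ R, Y * t - t * Y ∈ R := by
    intro X hX t ht
    obtain ⟨ht𝔥, httr⟩ := (hR t).1 ht
    refine (hR _).2 ⟨hbrC X hX t ht𝔥, fun Y hY => ?_⟩
    -- `tr((Xt − tX)Y) = tr(t(YX − XY)) = −tr(t[X,Y]) = 0`
    have e : (X * t - t * X) * Y = X * (t * Y) - t * (X * Y) := by rw [sub_mul, mul_assoc, mul_assoc]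
    have e3 : t * Y * X - t * (X * Y) = -(t * (X * Y - Y * X)) := by rw [mul_sub, mul_assoc]; abel
    rw [e, map_sub, LinearMap.trace_mul_comm ℂ X (t * Y), ← map_sub, e3, map_neg, httr _ (hbrC X hX Y hY), neg_zero]
  have hReq : R = H.hodgeLieC := hsimple R hRle hRne hRstab
  -- `Θ` lies in the radical: `tr(Θ Θ) = tr 1 = dim V = 0`, absurd
  have hΘR : Θ ∈ R := by rw [hReq]; exact hΘC
  have hΘΘ1 : Θ * Θ = 1 := LinearMap.ext fun v => by rw [Module.End.mul_apply, hΘΘ, Module.End.one_apply]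
  have h := ((hR Θ).1 hΘR).2 Θ hΘC
  rw [hΘΘ1, LinearMap.trace_one, Nat.cast_eq_zero] at h
  exact (Module.finrank_pos (R := ℂ) (M := ℂ ⊗[ℚ] V)).ne' h

/-! ## §4 The theorems -/

set_option maxHeartbeats 1600000 in
/-- **In a simple `𝔥_ℂ`, no non-zero Levi element commutes with all lowering operators.**  `H` effective polarized of weight
`1`; `𝔥_ℂ` simple; `B ∈ 𝔥_ℂ` raising, `B ≠ 0`; `Z ∈ 𝔥_ℂ` preserving `P` and `Q`, `Z ≠ 0`, with `Zz = zZ` for every lowering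
`z ∈ 𝔥_ℂ`.  Then `False`. [cite: Deligne1982HodgeCycles, I §3 Prop. 3.4, Prop. 3.6] [cite: MoonenZarhin1999LowDim, §2 (2.3)]
[cite: Humphreys1972, §4.3] -/
theorem false_of_levi_commute_lowering_of_simple (H : HodgeStructure V n) (ψ : H.Polarization) (hn : n = 1)
    (heff : H.IsEffective)
    (hsimple : ∀ T : Submodule ℂ (Module.End ℂ (ℂ ⊗[ℚ] V)), T ≤ H.hodgeLieC → T ≠ ⊥ →
      (∀ Y ∈ H.hodgeLieC, ∀ t ∈ T, Y * t - t * Y ∈ T) → T = H.hodgeLieC)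
    {B : Module.End ℂ (ℂ ⊗[ℚ] V)} (hB : B ∈ H.hodgeLieC) (hB0 : B ≠ 0) (hBP : ∀ p ∈ H.piece 1 0, B p = 0)
    (hBim : ∀ v, B v ∈ H.piece 1 0)
    {Z : Module.End ℂ (ℂ ⊗[ℚ] V)} (hZ : Z ∈ H.hodgeLieC) (hZ0 : Z ≠ 0) (hZP : ∀ p ∈ H.piece 1 0, Z p ∈ H.piece 1 0)
    (hZQ : ∀ q ∈ H.piece 0 1, Z q ∈ H.piece 0 1)
    (hZl : ∀ z ∈ H.hodgeLieC, (∀ q ∈ H.piece 0 1, z q = 0) → (∀ v, z v ∈ H.piece 0 1) → Z * z = z * Z) : False := by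
  have hV : Nontrivial (ℂ ⊗[ℚ] V) := by
    by_contra hV
    rw [not_nontrivial_iff_subsingleton] at hV
    exact hB0 (Subsingleton.elim _ _)
  refine hZ0 (LoweringCentralizer.eq_zero_of_forall_trace_mul_eq_zero H ψ hn heff hV hsimple hZ ?_)
  refine LoweringCentralizer.trace_mul_eq_zero H ψ hn heff hsimple hB hB0 hBP hBim hZP hZQ ?_
  intro x _ z hz _ _ hzQ hzim
  -- `tr(Z(xz − zx)) = tr(Zxz) − tr(Z z x) = tr(Zxz) − tr(z (Zx)) = 0`
  have e : Z * (x * z - z * x) = (Z * x) * z - z * (Z * x) := by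
    rw [mul_sub, ← mul_assoc Z z x, hZl z hz hzQ hzim]
    simp only [mul_assoc]
  rw [e, map_sub, LinearMap.trace_mul_comm, sub_self]

set_option maxHeartbeats 1600000 in
/-- **In a simple `𝔥_ℂ`, no non-zero Levi element commutes with all raising operators** (the mirror statement).
[cite: Deligne1982HodgeCycles, I §3 Prop. 3.4, Prop. 3.6] [cite: MoonenZarhin1999LowDim, §2 (2.3)] [cite: Humphreys1972, §4.3] -/
theorem false_of_levi_commute_raising_of_simple (H : HodgeStructure V n) (ψ : H.Polarization) (hn : n = 1)
    (heff : H.IsEffective)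
    (hsimple : ∀ T : Submodule ℂ (Module.End ℂ (ℂ ⊗[ℚ] V)), T ≤ H.hodgeLieC → T ≠ ⊥ →
      (∀ Y ∈ H.hodgeLieC, ∀ t ∈ T, Y * t - t * Y ∈ T) → T = H.hodgeLieC)
    {B : Module.End ℂ (ℂ ⊗[ℚ] V)} (hB : B ∈ H.hodgeLieC) (hB0 : B ≠ 0) (hBP : ∀ p ∈ H.piece 1 0, B p = 0)
    (hBim : ∀ v, B v ∈ H.piece 1 0)
    {Z : Module.End ℂ (ℂ ⊗[ℚ] V)} (hZ : Z ∈ H.hodgeLieC) (hZ0 : Z ≠ 0) (hZP : ∀ p ∈ H.piece 1 0, Z p ∈ H.piece 1 0)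
    (hZQ : ∀ q ∈ H.piece 0 1, Z q ∈ H.piece 0 1)
    (hZr : ∀ x ∈ H.hodgeLieC, (∀ p ∈ H.piece 1 0, x p = 0) → (∀ v, x v ∈ H.piece 1 0) → Z * x = x * Z) : False := by
  have hV : Nontrivial (ℂ ⊗[ℚ] V) := by
    by_contra hV
    rw [not_nontrivial_iff_subsingleton] at hV
    exact hB0 (Subsingleton.elim _ _)
  refine hZ0 (LoweringCentralizer.eq_zero_of_forall_trace_mul_eq_zero H ψ hn heff hV hsimple hZ ?_)
  refine LoweringCentralizer.trace_mul_eq_zero H ψ hn heff hsimple hB hB0 hBP hBim hZP hZQ ?_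
  intro x hx z _ hxP hxim _ _
  -- `tr(Z(xz − zx)) = tr(x(Zz)) − tr((Zz)x) = 0`
  have e : Z * (x * z - z * x) = x * (Z * z) - (Z * z) * x := by
    rw [mul_sub, ← mul_assoc Z x z, hZr x hx hxP hxim]
    simp only [mul_assoc]
  rw [e, map_sub, LinearMap.trace_mul_comm, sub_self]

end HodgeStructure

end Literature.AlgebraicGeometry.Motives
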